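import Literature.Geometry.GeometricMeasureTheory.CurrentsSlicingLipschitz
import Literature.Geometry.GeometricMeasureTheory.CurrentsWeakCompactness
import Literature.Geometry.GeometricMeasureTheory.CurrentsConstancy
import Literature.Geometry.GeometricMeasureTheory.VarifoldLimit
import Mathlib.MeasureTheory.Measure.Portmanteau
import Mathlib.Topology.MetricSpace.Sequences
import HarnessLib

/-!
# Restrictions and slices of weakly convergent sequences of currents

The "slicing lemma" of B. White's proof of the closure theorem [White1989, p. 210; Bandara 2006,
Thm. 3.1.3]: if `Tᵢ → T` weakly with `sup 𝐍(Tᵢ) < ∞`, then along a subsequence the variation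
measures `‖Tᵢ‖`, `‖∂Tᵢ‖` converge weakly to finite measures `μ`, `μ'`, and at every level `r`
charged by neither `μ` nor `μ'` (all but countably many) the restrictions `Tᵢ ⌞ {f > r}` and the
slices `⟨Tᵢ, f, r+⟩` converge weakly to `T ⌞ {f > r}` and `⟨T, f, r+⟩`. (Federer uses the same
mechanism in 4.2.16–4.2.17 through `𝓕`-convergence and `∫ 𝓕(⟨Tᵢ − T, u, r+⟩) dr ≤ 𝓕(Tᵢ − T)`;
the measure-theoretic form needs only weak convergence.) Proved here for the currents of
`Currents.lean` on a finite-dimensional real inner product space `V`: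

* `Current.exists_subseq_variation_tendsto` — **weak compactness of the variation measures**:
  for `𝐌(Tᵢ) ≤ c < ∞` and `spt Tᵢ ⊆ K` compact, a subsequence of `(‖Tᵢ‖)` converges in
  Mathlib's topology of weak convergence of finite measures (tightness from the common compact
  support, `‖T‖(V ∖ spt T) = 0`; Prokhorov via the tree's
  `exists_subseq_tendsto_of_isTightMeasureSet`, and the degenerate case of vanishing mass);
* `Current.IsRepresentable.abs_restrictSet_sub_smulFun_le` — **cutoff estimate**:
  `|(T ⌞ U)(φ) − T(g φ)| ≤ sup ‖φ‖ · ‖T‖(U ∖ F)` for a smooth `0 ≤ g ≤ 1` vanishing off `U` and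
  equal to `1` on `F ⊆ U` (the extension `T̄` to `L¹(‖T‖)` of `CurrentsRepresentable.lean`);
* **`Current.tendsto_restrictSet_apply_of_tendsto`** — if `Tᵢ → T` weakly, `‖Tᵢ‖ → μ` weakly and
  `μ(∂U) = 0` for an open `U`, then `(Tᵢ ⌞ U)(φ) → (T ⌞ U)(φ)` (smooth Urysohn cutoffs between
  `Uᶜ` and `{dist(·, Uᶜ) ≥ δ}`, the portmanteau inequality `limsup ‖Tᵢ‖(C) ≤ μ(C)` on the closed
  collars `C_δ = Ū ∩ {dist(·, Uᶜ) ≤ δ} ↓ ∂U`, and `‖T‖(U ∩ {dist(·,Uᶜ) < δ}) ↓ 0`);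
* **`Current.tendsto_slice_apply_of_tendsto`** — hence `⟨Tᵢ, f, r+⟩(φ) → ⟨T, f, r+⟩(φ)` at every
  level `r` with `μ{f = r} = 0 = μ'{f = r}`, where `‖Tᵢ‖ → μ`, `‖∂Tᵢ‖ → μ'`
  (`⟨T, f, r+⟩ = (∂T) ⌞ {f > r} − ∂(T ⌞ {f > r})`, `CurrentsSlicing.lean`);
* `countable_setOf_measure_levelSet_ne_zero_or` — the exceptional levels are countable.

Theorems only; no definitions, no named facts.

## References

* B. White, *A new proof of the compactness theorem for integral currents*, Comment. Math. Helv.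
  64 (1989) 207–220, p. 210 [White1989]; M. L. Bandara, *White's Compactness Theorem for Integral
  Currents* (Monash honours thesis, 2006), Thm. 3.1.3 (held: `lit paper:galaxy-pdf-8023002039701172160`).
* H. Federer, *Geometric Measure Theory*, Springer 1969, 4.1.5, 4.1.7, 4.2.1, 4.2.17 [Federer1969].
-/

noncomputable section

open scoped ENNReal NNReal Topology Manifold ContDiff
open MeasureTheory TopologicalSpace Set Filter Metric Function

namespace Literature.Geometry.GeometricMeasureTheory

set_option maxSynthPendingDepth 2

variable {V : Type*} [NormedAddCommGroup V] [InnerProductSpace ℝ V] [FiniteDimensional ℝ V]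
  [MeasurableSpace V] [BorelSpace V] {m : ℕ}

/-! ### Weak compactness of the variation measures -/

section VariationCompactness

/-- **The variation measures of a mass-bounded sequence with common compact support have a weakly
convergent subsequence**: for `𝐌(Tᵢ) ≤ c < ∞` and `spt Tᵢ ⊆ K`, `K` compact, there are a
subsequence `ι` and a finite measure `μ` with `‖T_{ι j}‖ → μ` weakly (as finite measures).
[cite: Federer1969, 4.2.17 (1); White1989, p. 210] -/
theorem Current.exists_subseq_variation_tendsto (T : ℕ → Current (⊤ : Opens V) m) {c : ℝ≥0∞}
    (hc : c ≠ ⊤) (hT : ∀ i, (T i).mass ≤ c) {K : Set V} (hK : IsCompact K)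
    (hTK : ∀ i, (T i).support ⊆ K) :
    ∃ (ι : ℕ → ℕ) (μs : ℕ → FiniteMeasure V) (μ : FiniteMeasure V), StrictMono ι ∧
      (∀ j, ((μs j : FiniteMeasure V) : Measure V) = (T (ι j)).variation) ∧
      Tendsto μs atTop (𝓝 μ) := by
  have hTm : ∀ i, (T i).mass ≠ ⊤ := fun i => ne_top_of_le_ne_top hc (hT i)
  haveI : ∀ i, IsFiniteMeasure (T i).variation := fun i => (T i).isFiniteMeasure_variation (hTm i)
  set νs : ℕ → FiniteMeasure V := fun i => ⟨(T i).variation, inferInstance⟩ with hνs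
  have hνs_coe : ∀ i, ((νs i : FiniteMeasure V) : Measure V) = (T i).variation := fun i => rfl
  -- tightness from the common compact support
  have htight : IsTightMeasureSet (Set.range fun i => ((νs i : FiniteMeasure V) : Measure V)) := by
    rw [isTightMeasureSet_iff_exists_isCompact_measure_compl_le]
    intro ε _
    refine ⟨K, hK, ?_⟩
    rintro _ ⟨i, rfl⟩
    have hsub : Kᶜ ⊆ ((⊤ : Opens V) : Set V) \ (T i).support := fun x hx =>
      ⟨TopologicalSpace.Opens.mem_top x, fun h => hx (hTK i h)⟩
    have h0 : (T i).variation Kᶜ = 0 := measure_mono_null hsub (T i).variation_sdiff_support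
    show ((νs i : FiniteMeasure V) : Measure V) Kᶜ ≤ _
    rw [hνs_coe, h0]
    exact bot_le
  -- masses are bounded: a subsequence along which they converge
  have hbdd : ∀ i, (νs i).mass ∈ Set.Icc (0 : ℝ≥0) c.toNNReal := fun i => by
    refine ⟨bot_le, ?_⟩
    rw [← ENNReal.coe_le_coe, FiniteMeasure.ennreal_mass, hνs_coe, Current.variation_univ,
      ENNReal.coe_toNNReal hc]
    exact hT i
  obtain ⟨M, -, ι₁, hι₁, hM⟩ := tendsto_subseq_of_bounded (Metric.isBounded_Icc (0 : ℝ≥0) c.toNNReal)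
    hbdd
  by_cases hM0 : M = 0
  · -- vanishing mass: the measures converge to `0`
    refine ⟨ι₁, fun j => νs (ι₁ j), 0, hι₁, fun j => rfl, ?_⟩
    apply FiniteMeasure.tendsto_zero_of_tendsto_zero_mass
    rw [← hM0]
    exact hM
  · have hMpos : 0 < M := pos_iff_ne_zero.2 hM0
    obtain ⟨ι₂, hι₂, μ, -, hlim⟩ := exists_subseq_tendsto_of_isTightMeasureSet (fun j => νs (ι₁ j))
      (htight.subset (by rintro _ ⟨j, rfl⟩; exact ⟨ι₁ j, rfl⟩)) hMpos hM
    exact ⟨ι₁ ∘ ι₂, fun j => νs (ι₁ (ι₂ j)), μ, hι₁.comp hι₂, fun j => rfl, hlim⟩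

end VariationCompactness

/-! ### The cutoff estimate -/

section Cutoff

/-- **Cutoff estimate**: for `T` of finite mass, an open (measurable) `U`, a measurable `F ⊆ U` and
a smooth `g : V → [0, 1]` with `g = 0` off `U` and `g = 1` on `F`,
`|(T ⌞ U)(φ) − T(g φ)| ≤ C · ‖T‖(U ∖ F)` whenever `‖φ‖ ≤ C` pointwise — both sides are values of the
extension `T̄` on `L¹(‖T‖)`, and `|1_U φ − g φ| ≤ 1_{U ∖ F} ‖φ‖`. [cite: Federer1969, 4.1.5, 4.1.7] -/
theorem Current.IsRepresentable.abs_restrictSet_sub_smulFun_le {T : Current (⊤ : Opens V) m}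
    (hT : T.IsRepresentable) (hTm : T.mass ≠ ⊤) {U F : Set V} (hU : MeasurableSet U)
    (hF : MeasurableSet F) {g : V → ℝ} (hg : ContDiff ℝ ∞ g)
    (hg01 : ∀ x, g x ∈ Icc (0 : ℝ) 1) (hg0 : ∀ x ∉ U, g x = 0) (hg1 : ∀ x ∈ F, g x = 1)
    (φ : TestForm (⊤ : Opens V) m) {C : ℝ} (hC : ∀ x, ‖φ x‖ ≤ C) :
    |hT.restrictSet U hU φ - T (TestForm.smulFun hg φ)| ≤ C * (T.variation (U \ F)).toReal := by
  have hC0 : 0 ≤ C := (norm_nonneg _).trans (hC 0)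
  have hiU : Integrable (U.indicator ⇑φ) T.variation := (hT.integrable_testForm φ).indicator hU
  have hig : Integrable (⇑(TestForm.smulFun hg φ)) T.variation :=
    hT.integrable_testForm (TestForm.smulFun hg φ)
  rw [hT.restrictSet_apply, ← hT.extend_toL1 (TestForm.smulFun hg φ), hT.toL1_apply, ← map_sub,
    ← Integrable.toL1_sub _ _ hiU hig]
  refine (hT.abs_extend_toL1_le (hiU.sub hig)).trans ?_
  -- pointwise bound of the integrand
  have hpt : ∀ x, ‖(U.indicator ⇑φ - ⇑(TestForm.smulFun hg φ)) x‖ₑ ≤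
      (U \ F).indicator (fun _ => ENNReal.ofReal C) x := by
    intro x
    simp only [Pi.sub_apply, TestForm.smulFun_apply]
    by_cases hxU : x ∈ U
    · by_cases hxF : x ∈ F
      · rw [indicator_of_mem hxU, hg1 x hxF, one_smul, sub_self, enorm_zero]; exact bot_le
      · rw [indicator_of_mem (show x ∈ U \ F from ⟨hxU, hxF⟩), indicator_of_mem hxU, ← ofReal_norm]
        apply ENNReal.ofReal_le_ofReal
        have h01 := hg01 x
        calc ‖φ x - g x • φ x‖ = ‖(1 - g x) • φ x‖ := by rw [sub_smul, one_smul]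
          _ = |1 - g x| * ‖φ x‖ := by rw [norm_smul, Real.norm_eq_abs]
          _ ≤ 1 * C := mul_le_mul (by rw [abs_le]; constructor <;> linarith [h01.1, h01.2]) (hC x)
              (norm_nonneg _) zero_le_one
          _ = C := one_mul C
    · rw [indicator_of_notMem hxU, hg0 x hxU, zero_smul, sub_self, enorm_zero]; exact bot_le
  have hfin : T.variation (U \ F) ≠ ⊤ := ne_top_of_le_ne_top hTm (T.variation_le_mass _)
  calc (∫⁻ x, ‖(U.indicator ⇑φ - ⇑(TestForm.smulFun hg φ)) x‖ₑ ∂T.variation).toReal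
      ≤ (∫⁻ x, (U \ F).indicator (fun _ => ENNReal.ofReal C) x ∂T.variation).toReal := by
        refine ENNReal.toReal_mono ?_ (lintegral_mono hpt)
        rw [lintegral_indicator (hU.diff hF), setLIntegral_const]
        exact ENNReal.mul_ne_top ENNReal.ofReal_ne_top hfin
    _ = C * (T.variation (U \ F)).toReal := by
        rw [lintegral_indicator (hU.diff hF), setLIntegral_const, ENNReal.toReal_mul,
          ENNReal.toReal_ofReal hC0]

end Cutoff

/-! ### Restrictions of weakly convergent sequences converge at uncharged open sets -/

section RestrictLimit

omit [InnerProductSpace ℝ V] [FiniteDimensional ℝ V] [MeasurableSpace V] [BorelSpace V] in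
/-- The closed collars `Ū ∩ {dist(·, Uᶜ) ≤ 1/(n+1)}` decrease to the frontier of `U`.
[folklore] -/
private theorem iInter_closure_inter_cthickening_eq_frontier (U : Set V) :
    (⋂ n : ℕ, closure U ∩ cthickening (1 / ((n : ℝ) + 1)) Uᶜ) = frontier U := by
  rw [frontier_eq_closure_inter_closure, ← Set.inter_iInter]
  congr 1
  apply Subset.antisymm
  · intro x hx
    rw [Set.mem_iInter] at hx
    rw [Metric.closure_eq_iInter_cthickening]
    refine Set.mem_iInter₂.2 fun δ hδ => ?_
    obtain ⟨n, hn⟩ := exists_nat_one_div_lt hδ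
    exact cthickening_mono hn.le _ (hx n)
  · exact Set.subset_iInter fun n => closure_subset_cthickening _ _

omit [InnerProductSpace ℝ V] [FiniteDimensional ℝ V] [MeasurableSpace V] [BorelSpace V] in
/-- The open collars `U ∩ {dist(·, Uᶜ) < 1/(n+1)}` of an open set decrease to `∅`. [folklore] -/
private theorem iInter_inter_thickening_compl_eq_empty {U : Set V} (hU : IsOpen U) :
    (⋂ n : ℕ, U ∩ thickening (1 / ((n : ℝ) + 1)) Uᶜ) = ∅ := by
  rw [← Set.inter_iInter]
  have h : (⋂ n : ℕ, thickening (1 / ((n : ℝ) + 1)) Uᶜ) = Uᶜ := by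
    apply Subset.antisymm
    · intro x hx
      rw [Set.mem_iInter] at hx
      rw [← hU.isClosed_compl.closure_eq, Metric.closure_eq_iInter_thickening]
      refine Set.mem_iInter₂.2 fun δ hδ => ?_
      obtain ⟨n, hn⟩ := exists_nat_one_div_lt hδ
      exact thickening_mono hn.le _ (hx n)
    · exact Set.subset_iInter fun n => self_subset_thickening (by positivity) _
  rw [h, Set.inter_compl_self]

/-- **Restrictions of a weakly convergent sequence converge at every open set whose frontier the
limit variation does not charge**: if `Tᵢ → T` weakly (all of finite mass), the variation
measures `‖Tᵢ‖` converge weakly to a finite measure `μ`, and `μ(∂U) = 0` for the open set `U`, then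
`(Tᵢ ⌞ U)(φ) → (T ⌞ U)(φ)` for every test form `φ`. (No relation between `‖T‖` and `μ` is needed:
`‖T‖` of the inner collars tends to `0` by itself.) [cite: White1989, p. 210; Federer1969, 4.1.7] -/
theorem Current.tendsto_restrictSet_apply_of_tendsto {T : ℕ → Current (⊤ : Opens V) m}
    {T' : Current (⊤ : Opens V) m} (hTr : ∀ i, (T i).IsRepresentable) (hT'r : T'.IsRepresentable)
    (hT'm : T'.mass ≠ ⊤) (hw : ∀ φ, Tendsto (fun i => T i φ) atTop (𝓝 (T' φ)))
    {μs : ℕ → FiniteMeasure V} {μ : FiniteMeasure V}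
    (hμs : ∀ i, ((μs i : FiniteMeasure V) : Measure V) = (T i).variation)
    (hlim : Tendsto μs atTop (𝓝 μ)) {U : Set V} (hU : IsOpen U)
    (hμU : (μ : Measure V) (frontier U) = 0) (φ : TestForm (⊤ : Opens V) m) :
    Tendsto (fun i => (hTr i).restrictSet U hU.measurableSet φ) atTop
      (𝓝 (hT'r.restrictSet U hU.measurableSet φ)) := by
  have hTm : ∀ i, (T i).mass ≠ ⊤ := fun i => by
    rw [← Current.variation_univ, ← hμs i]; exact measure_ne_top _ _
  haveI : IsFiniteMeasure T'.variation := T'.isFiniteMeasure_variation hT'm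
  obtain ⟨C, hC, hφC⟩ := TestForm.exists_pos_forall_norm_le φ
  -- the collars
  set Cl : ℕ → Set V := fun n => closure U ∩ cthickening (1 / ((n : ℝ) + 1)) Uᶜ with hCl
  set Ly : ℕ → Set V := fun n => U ∩ thickening (1 / ((n : ℝ) + 1)) Uᶜ with hLy
  have hLyCl : ∀ n, Ly n ⊆ Cl n := fun n x hx =>
    ⟨subset_closure hx.1, thickening_subset_cthickening _ _ hx.2⟩
  have hCl_closed : ∀ n, IsClosed (Cl n) := fun n => isClosed_closure.inter isClosed_cthickening
  have hLy_meas : ∀ n, MeasurableSet (Ly n) := fun n =>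
    hU.measurableSet.inter isOpen_thickening.measurableSet
  have hanti : ∀ n n' : ℕ, n ≤ n' → (1 : ℝ) / ((n' : ℝ) + 1) ≤ 1 / ((n : ℝ) + 1) := fun n n' h =>
    one_div_le_one_div_of_le (by positivity) (by exact_mod_cast Nat.add_le_add_right h 1)
  -- `μ (Cl n) → 0`
  have hμCl : Tendsto (fun n => (μ : Measure V) (Cl n)) atTop (𝓝 0) := by
    have h := tendsto_measure_iInter_atTop (μ := (μ : Measure V))
      (fun n => (hCl_closed n).measurableSet.nullMeasurableSet)
      (fun n n' h => Set.inter_subset_inter_right _ (cthickening_mono (hanti n n' h) _))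
      ⟨0, measure_ne_top _ _⟩
    rwa [hCl, iInter_closure_inter_cthickening_eq_frontier U, hμU] at h
  -- `‖T'‖ (Ly n) → 0`
  have hT'Ly : Tendsto (fun n => T'.variation (Ly n)) atTop (𝓝 0) := by
    have h := tendsto_measure_iInter_atTop (μ := T'.variation)
      (fun n => (hLy_meas n).nullMeasurableSet)
      (fun n n' h => Set.inter_subset_inter_right _ (thickening_mono (hanti n n' h) _))
      ⟨0, measure_ne_top _ _⟩
    rwa [hLy, iInter_inter_thickening_compl_eq_empty hU, measure_empty] at h
  -- the `ε`-argument
  refine Metric.tendsto_nhds.2 fun ε hε => ?_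
  set η : ℝ := ε / (4 * C) with hη
  have hη0 : 0 < η := by positivity
  have hη' : (0 : ℝ≥0∞) < ENNReal.ofReal η := ENNReal.ofReal_pos.2 hη0
  obtain ⟨n, hn1, hn2⟩ := ((hμCl.eventually (gt_mem_nhds hη')).and
    (hT'Ly.eventually (gt_mem_nhds hη'))).exists
  set δ : ℝ := 1 / ((n : ℝ) + 1) with hδ
  have hδ0 : 0 < δ := by positivity
  set F : Set V := (thickening δ Uᶜ)ᶜ with hF
  have hFU : U \ F = Ly n := by
    simp only [hF, hLy, hδ, Set.sdiff_eq, compl_compl]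
  have hF_closed : IsClosed F := isOpen_thickening.isClosed_compl
  -- smooth cutoff: `g = 0` on `Uᶜ`, `g = 1` on `F`
  obtain ⟨g, hg0, hg1, hg01⟩ := exists_contMDiffMap_zero_one_of_isClosed 𝓘(ℝ, V) (n := (⊤ : ℕ∞))
    hU.isClosed_compl hF_closed
    (Set.disjoint_compl_right_iff_subset.2 (self_subset_thickening hδ0 _))
  have hgs : ContDiff ℝ ∞ ⇑g := g.contMDiff.contDiff
  have hg0' : ∀ x ∉ U, g x = 0 := fun x hx => hg0 hx
  have hg1' : ∀ x ∈ F, g x = 1 := fun x hx => hg1 hx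
  -- the three pieces
  have hest : ∀ i, |(hTr i).restrictSet U hU.measurableSet φ - T i (TestForm.smulFun hgs φ)| ≤
      C * ((T i).variation (Ly n)).toReal := fun i => by
    rw [← hFU]
    exact (hTr i).abs_restrictSet_sub_smulFun_le (hTm i) hU.measurableSet hF_closed.measurableSet
      hgs hg01 hg0' hg1' φ hφC
  have hest' : |hT'r.restrictSet U hU.measurableSet φ - T' (TestForm.smulFun hgs φ)| ≤
      C * (T'.variation (Ly n)).toReal := by
    rw [← hFU]
    exact hT'r.abs_restrictSet_sub_smulFun_le hT'm hU.measurableSet hF_closed.measurableSet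
      hgs hg01 hg0' hg1' φ hφC
  -- eventually `‖Tᵢ‖(Cl n) < μ(Cl n) + η ≤ 2η`
  have hlimsup : limsup (fun i => ((μs i : FiniteMeasure V) : Measure V) (Cl n)) atTop ≤
      (μ : Measure V) (Cl n) :=
    FiniteMeasure.limsup_measure_closed_le_of_tendsto hlim (hCl_closed n)
  have hev1 : ∀ᶠ i in atTop, ((μs i : FiniteMeasure V) : Measure V) (Cl n) <
      (μ : Measure V) (Cl n) + ENNReal.ofReal η :=
    eventually_lt_of_limsup_lt (lt_of_le_of_lt hlimsup
      (ENNReal.lt_add_right (measure_ne_top _ _) hη'.ne'))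
  have hev2 : ∀ᶠ i in atTop, dist (T i (TestForm.smulFun hgs φ)) (T' (TestForm.smulFun hgs φ)) <
      ε / 4 := Metric.tendsto_nhds.1 (hw _) _ (by positivity)
  filter_upwards [hev1, hev2] with i hi1 hi2
  -- bound on `‖Tᵢ‖(Ly n)`
  have hvar_i : ((T i).variation (Ly n)).toReal < 2 * η := by
    have h1 : (T i).variation (Ly n) < ENNReal.ofReal η + ENNReal.ofReal η :=
      calc (T i).variation (Ly n) ≤ (T i).variation (Cl n) := measure_mono (hLyCl n)
        _ = ((μs i : FiniteMeasure V) : Measure V) (Cl n) := by rw [hμs i]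
        _ < (μ : Measure V) (Cl n) + ENNReal.ofReal η := hi1
        _ ≤ ENNReal.ofReal η + ENNReal.ofReal η := add_le_add hn1.le le_rfl
    have h2 : ENNReal.ofReal η + ENNReal.ofReal η = ENNReal.ofReal (2 * η) := by
      rw [← ENNReal.ofReal_add hη0.le hη0.le]; ring_nf
    rw [h2] at h1
    exact (ENNReal.toReal_lt_of_lt_ofReal h1)
  have hvar' : (T'.variation (Ly n)).toReal < η := ENNReal.toReal_lt_of_lt_ofReal hn2
  rw [Real.dist_eq] at hi2 ⊢
  have hCη : C * η = ε / 4 := by rw [hη]; field_simp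
  calc |(hTr i).restrictSet U hU.measurableSet φ - hT'r.restrictSet U hU.measurableSet φ|
      ≤ |(hTr i).restrictSet U hU.measurableSet φ - T i (TestForm.smulFun hgs φ)| +
          |T i (TestForm.smulFun hgs φ) - T' (TestForm.smulFun hgs φ)| +
          |T' (TestForm.smulFun hgs φ) - hT'r.restrictSet U hU.measurableSet φ| := by
        have := abs_sub_le ((hTr i).restrictSet U hU.measurableSet φ)
          (T i (TestForm.smulFun hgs φ)) (hT'r.restrictSet U hU.measurableSet φ)
        have := abs_sub_le (T i (TestForm.smulFun hgs φ)) (T' (TestForm.smulFun hgs φ))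
          (hT'r.restrictSet U hU.measurableSet φ)
        linarith
    _ < C * (2 * η) + ε / 4 + C * η := by
        have h3 : |T' (TestForm.smulFun hgs φ) - hT'r.restrictSet U hU.measurableSet φ| ≤
            C * (T'.variation (Ly n)).toReal := by rw [abs_sub_comm]; exact hest'
        have h4 := hest i
        have h5 : C * ((T i).variation (Ly n)).toReal < C * (2 * η) :=
          mul_lt_mul_of_pos_left hvar_i hC
        have h6 : C * (T'.variation (Ly n)).toReal ≤ C * η :=
          mul_le_mul_of_nonneg_left hvar'.le hC.le
        linarith
    _ = ε := by nlinarith [hCη]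

end RestrictLimit

/-! ### Slices of weakly convergent sequences converge at uncharged levels -/

section SliceLimit

variable {k : ℕ}

/-- **Slices of a weakly convergent sequence converge at uncharged levels** (White's slicing
lemma): if `Tᵢ → T` weakly, `‖Tᵢ‖ → μ` and `‖∂Tᵢ‖ → μ'` weakly (finite measures), `T`, `∂T` of
finite mass, `f` continuous and `μ{f = r} = 0 = μ'{f = r}`, then
`⟨Tᵢ, f, r+⟩(φ) → ⟨T, f, r+⟩(φ)` for every test form `φ`.
[cite: White1989, p. 210; Federer1969, 4.2.1] -/
theorem Current.tendsto_slice_apply_of_tendsto {T : ℕ → Current (⊤ : Opens V) (k + 1)}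
    {T' : Current (⊤ : Opens V) (k + 1)} (hTr : ∀ i, (T i).IsRepresentable)
    (hdTr : ∀ i, (T i).boundary.IsRepresentable) (hT'r : T'.IsRepresentable)
    (hdT'r : T'.boundary.IsRepresentable) (hT'm : T'.mass ≠ ⊤) (hdT'm : T'.boundary.mass ≠ ⊤)
    (hw : ∀ φ, Tendsto (fun i => T i φ) atTop (𝓝 (T' φ)))
    {μs νs : ℕ → FiniteMeasure V} {μ ν : FiniteMeasure V}
    (hμs : ∀ i, ((μs i : FiniteMeasure V) : Measure V) = (T i).variation)
    (hνs : ∀ i, ((νs i : FiniteMeasure V) : Measure V) = (T i).boundary.variation)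
    (hμ : Tendsto μs atTop (𝓝 μ)) (hν : Tendsto νs atTop (𝓝 ν))
    {f : V → ℝ} (hf : Continuous f) {r : ℝ} (hμr : (μ : Measure V) {x | f x = r} = 0)
    (hνr : (ν : Measure V) {x | f x = r} = 0) (φ : TestForm (⊤ : Opens V) k) :
    Tendsto (fun i => (hTr i).slice (hdTr i) hf r φ) atTop (𝓝 (hT'r.slice hdT'r hf r φ)) := by
  have hUo : IsOpen {x : V | r < f x} := isOpen_lt continuous_const hf
  have hfr : frontier {x : V | r < f x} ⊆ {x | f x = r} := fun x hx => by
    have := frontier_lt_subset_eq continuous_const hf hx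
    exact this.symm
  have hμU : (μ : Measure V) (frontier {x : V | r < f x}) = 0 := measure_mono_null hfr hμr
  have hνU : (ν : Measure V) (frontier {x : V | r < f x}) = 0 := measure_mono_null hfr hνr
  have hwb : ∀ ψ, Tendsto (fun i => (T i).boundary ψ) atTop (𝓝 (T'.boundary ψ)) :=
    Current.tendsto_boundary_apply hw
  have h1 := Current.tendsto_restrictSet_apply_of_tendsto hdTr hdT'r hdT'm hwb hνs hν hUo hνU φ
  have h2 := Current.tendsto_restrictSet_apply_of_tendsto hTr hT'r hT'm hw hμs hμ hUo hμU
    (TestForm.extDerivCLM φ)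
  simp_rw [Current.IsRepresentable.slice_apply]
  exact h1.sub h2

omit [BorelSpace V] in
/-- **The exceptional levels are countable**: for finite measures `μ`, `ν` and a measurable `f`, all
but countably many `r` have `μ{f = r} = 0 = ν{f = r}` (Federer 4.2.1: "`‖T‖ {x : u(x) = r} = 0`
for all but countably many `r`"). [cite: Federer1969, 4.2.1 and 2.9.5] -/
theorem countable_setOf_measure_levelSet_ne_zero_or (μ ν : Measure V) [IsFiniteMeasure μ]
    [IsFiniteMeasure ν] {f : V → ℝ} (hf : Measurable f) :
    {r : ℝ | μ {x | f x = r} ≠ 0 ∨ ν {x | f x = r} ≠ 0}.Countable := by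
  have h1 := Measure.countable_meas_level_set_pos (μ := μ) hf
  have h2 := Measure.countable_meas_level_set_pos (μ := ν) hf
  refine ((h1.union h2).mono fun r hr => ?_)
  rcases hr with hr | hr
  · exact Or.inl (pos_iff_ne_zero.2 hr)
  · exact Or.inr (pos_iff_ne_zero.2 hr)

omit [BorelSpace V] in
/-- **Almost every level is uncharged** by two finite measures (Federer 4.2.1: "for `ℒ¹` almost all
`r`"). [cite: Federer1969, 4.2.1] -/
theorem ae_measure_levelSet_eq_zero_and (μ ν : Measure V) [IsFiniteMeasure μ] [IsFiniteMeasure ν]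
    {f : V → ℝ} (hf : Measurable f) :
    ∀ᵐ r : ℝ, μ {x | f x = r} = 0 ∧ ν {x | f x = r} = 0 := by
  have h := (countable_setOf_measure_levelSet_ne_zero_or μ ν hf).ae_notMem (volume : Measure ℝ)
  filter_upwards [h] with r hr
  simp only [not_or, not_not] at hr
  exact hr

end SliceLimit

end Literature.Geometry.GeometricMeasureTheory
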